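import Literature.MathematicalPhysics.QuantumFieldTheory.Balaban1983to89.B9WalkLettersKernels
import Literature.MathematicalPhysics.QuantumFieldTheory.Balaban1983to89.B9WalkLettersCoordsLeib
import Literature.MathematicalPhysics.QuantumFieldTheory.Balaban1983to89.B9Cor38WholeDir
import Literature.MathematicalPhysics.QuantumFieldTheory.Balaban1983to89.B9GeoNbrCountKLevelV1

/-!
# `Balaban1983to89.B9WalkLettersOps` — W-a FILE C-2 (part 3, definitions): THE RECORD `opsWalkY` OF THE rows-18 WALK LETTERS (3.87)–(3.90) AT
# node00-def-Y's MEMBERS — the `B9Thm37Whole.Ops ∕ DirOps37 ∕ DirLetters37 ∕ Sizes` records and the walk reading's agreement predicate of the N06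
# certificate, INSTANTIATED by the coordinate models (part 1), the static letters (C-1) and the kernels of record (part 2b)

statement-level skeleton of published theorems with citation tags; proofs where landed; nothing here is a claim about the Yang–Mills mass gap

B9 = T. Bałaban, *Propagators for lattice gauge theories in a background field*, Commun. Math. Phys. **99** (1985) 389–434 [Balaban1985BackgroundPropagators];
[4] = T. Bałaban, *Propagators and renormalization transformations for lattice gauge theories. II*, Commun. Math. Phys. **96** (1984) 223–250 [Balaban1984PropagatorsII].
THE PRINT.  (3.87) p.409 `G′₀ = Σ_□ h_□G′_□h_□`; (3.88) `Δ′_aG′₀ = I − Σ_□ K(h_□)G′_□h_□`, `K(h_□) = Σ_μ P_□,μ∇_{U,μ} + C_□`; (3.89) «K(h_□) … of size O(M⁻¹)»;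
(3.90) the random-walk expansion; p.410 «A propagator G′_□ depends on U restricted to Ω₀(□) ⊂ □̃⁵»; [4] (2.36)–(2.44) pp.229–230.
WHY THIS FILE (pub-ymgap, dag-n06-d W-a C-2 programme, HOME `W-a-C2-PLAN.md` §1; node00-def-Y `W-a-DESIGN.md`).  The N06 certificate (edition 46,
`Summit…N06AtOpsYNuOfRecordV6EPairOA`) DISPLAYS the rows-18 letters `𝔬 : ∀ x, Ops (geo9Y x) (bg9YR …) (XSK …) (XSK …) ↥(cubes …)`, `𝔡`, `𝔩`, `κ`, `rd` with the
pins `hblkS hblkYS hhS hGsqF hGpS hDS hDsS hLapS h𝔡d h𝔡s` and the static ∕ algebraic binders `hst hκ hrd hloc` + `h36`'s `Identities₂` conjunct.  This file gives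
THE RECORD the pins describe, field by field (every pin then holds by `rfl`):
* `opsWalkY x b B cfg parS bI` — `blk = blkY := blkSK (sIK bI)`, `S = S′ := SblkY x bI` (part 2b-I: the one-step thickening of `supp h_□` stays in `□̃`),
  `h = hY := hWalkY x`, the nine kernels of record (`B9WalkLettersKernels`), `Gp := GcoS … (GpY parS)`, `Δa := dacoS`, `Gsq := gsqcoS x … c`, `D := DcoS`,
  `Dstar := DscoS`, `Lap := LcoS`, `Cop ∕ Ct ∕ CL ∕ CD ∕ CLt := ccoS ∕ ctcoS ∕ clcoS ∕ cdcoS ∕ cltcoS` at `h := hTY c` (part 1), and the dead letters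
  `P ∕ PL ∕ Pt ∕ PD := 0` (ruling R1′: `Identities₂` reads the direction letters from `𝔩`; `P^D := 0` by (3.100));
* `dirOpsWalkY` (`Dd ∕ Dsd := dirDcoS ∕ dirDscoS`, the pins `h𝔡d ∕ h𝔡s`), `dirLettersWalkY` (`P ∕ PL ∕ Pt := pcoS ∕ plcoS ∕ ptcoS` at `hTY c`, `KPd ∕ KPLd ∕ KPtd := kPdY ∕
  kPLdY ∕ kPtdY`), `kappaWalkY x b` (the nine sizes of `B9WalkLettersKernelsRows`, explicit `O(M_h⁻¹)` constants), `nearDomY` ∕ `agreeWalkY` (print's «U restricted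
  to □̃⁵»: agreement of the bond variables one step around `□̃(c)` and of the averaging transporters on `□̃(c)` — def-Y's `GsqY_congr_of_agree` hypotheses, thickened
  for the stencils of `∇_U`, `K(h_□)`), `rdWalkY` (`ev := evSK`, `Agree := agreeWalkY`); the member-uniform constants `thetaWalkY` (θ₀ of `Sizes.Bounded.row∕col`, M = L·M_h) and `KcWalkY`
  (Leibniz sizes);
* the `rfl` pins `opsWalkY_static ∕ _kernels ∕ _letters`, `dirWalkY_letters`, `dirOpsWalkY_pins`, `rdWalkY_fields`, `dirLettersWalkY_sums` (`Identities₂.KPd_sum`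
  with equality).
The theorems `staticOK_opsWalkY`, `bounded_kappaWalkY`, `identities₂_opsWalkY`, `localityDir_opsWalkY` are part 3 (proofs); the strict `WalkReading.OK.off` displayed
by the certificate is unsatisfiable by a faithful reading (`β : IBondY → 𝔅` is (d+1)-to-1) — bus WORD-W1, l.42852; `rdWalkY` satisfies the `RelB` form.
HONEST SCOPE.  Definitions with bodies + `rfl` bookkeeping; nothing of [B9] asserted; no regime; count-neutral; N06 NOT discharged; nothing continuum ∕ OS ∕ mass gap ∕
Clay.  Cell `pub-ymgap` (D-0062), node N06 [B9], rows 18, seat `pub-ymgap-dag-n06-d` (gen 14).  Net new unproved facts: 0.  NEW file.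
-/

noncomputable section

namespace Literature.MathematicalPhysics.QuantumFieldTheory.Balaban1983to89.B9WalkLettersOps

open Node00
open B6KLevelCensusIndexV1 (KIdx)
open B6Cover236MultiLevelBlocks (cubes)
open B6Partition118KLevelFineSizes (C1F)
open B6Partition118KLevelFineSecond (C2F)
open B6Partition118KLevelTorusBinders (sLipT)
open B9Thm37Whole (Ops Sizes)
open B9RWSums346SecondDiffGp (DirOps37)
open B9Thm37WholeDir (DirLetters37)
open B9Thm37CubeCoverCommutators (hTY)
open B9Thm39ReadingCoords (cR39)
open B9Ineq349SiteComposite (cdSL cdsSL)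
open B9GeoNbrCountKLevelV1 (nbrCountY)
open B9PinMembersKLevelV1 (MemberY geo9Y)
open B9CoReadingCoordsS (XSK blkSK sIK GcoS DcoS DscoS LcoS)
open B9WalkLettersCoordsS (cubeDomY SblkY hWalkY gsqcoS)
open B9WalkLettersCoordsLeib (pcoS ptcoS plcoS ccoS ctcoS clcoS cdcoS cltcoS dacoS dirDcoS dirDscoS)
open B9WalkLettersKernels

variable {d ℓ : ℕ} {hd : 1 ≤ d + 1} {hL : Odd (ℓ + 1) ∧ 1 < ℓ + 1} {b₀ b₁ : ℝ} {Mstar : ℕ}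
variable {𝔸 : Type} [NormedRing 𝔸] [NormedAlgebra ℂ 𝔸] [CompleteSpace 𝔸] [FiniteDimensional ℝ 𝔸] {κ : Type} [Fintype κ] [DecidableEq κ]
variable (x : MemberY d ℓ hd hL b₀ b₁ Mstar) (b : Module.Basis κ ℝ 𝔸) (B : B9.Backgrounds) (cfg : B.Cfg → CfgY 𝔸 x.toKIdx) (parS : SiteParY 𝔸 x.toKIdx)
variable (bI : FBondY x.toKIdx → IBondY x.toKIdx)

/-! ## §1 The record of the walk letters -/

/-- ★★★ **THE rows-18 WALK LETTERS OF RECORD** `opsWalkY`: the `Ops` record of (3.87)–(3.90) at a member, every `U`-dependent field the coordinate model of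
def-Y's 𝔸-level letter, every static field the C-1 ∕ part-2b object (see the module docstring for the field table).
[cite: Balaban1985BackgroundPropagators, (3.87)–(3.90) pp.408–409; Balaban1984PropagatorsII, (2.36)–(2.44) pp.229–230] -/
def opsWalkY : Ops (geo9Y x) B (XSK κ x.toKIdx) (XSK κ x.toKIdx) ↥(cubes x.toKIdx.D.toDomains) where
  blk := blkSK x.toKIdx (sIK x.toKIdx bI)
  blkY := blkSK x.toKIdx (sIK x.toKIdx bI)
  S := SblkY x bI
  S' := SblkY x bI
  h := hWalkY x
  hY := hWalkY x
  KP := kPY x b bI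
  KC := kCY x b bI
  KPD := kPDY x
  KCD := kCDY x b bI
  KPL := kPLY x b bI
  KCL := kCLY x b bI
  KPt := kPtY x b bI
  KCt := kCtY x b bI
  KCLt := kCLtY x b bI
  Gp := fun U => GcoS x.toKIdx b B cfg (GpY x.toKIdx parS) U
  Δa := fun U => dacoS x.toKIdx b B cfg parS U
  Gsq := fun U c => gsqcoS x b B cfg parS c U
  D := fun U => DcoS x.toKIdx b B cfg U
  Dstar := fun U => DscoS x.toKIdx b B cfg U
  Lap := fun U => LcoS x.toKIdx b B cfg U
  P := fun _ _ => 0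
  Cop := fun U c => ccoS x.toKIdx b B cfg parS U (hTY x.toKIdx c)
  PD := fun _ _ => 0
  CD := fun U c => cdcoS x.toKIdx b B cfg U (hTY x.toKIdx c)
  PL := fun _ _ => 0
  CL := fun _ c => clcoS x.toKIdx b (hTY x.toKIdx c)
  Pt := fun _ _ => 0
  Ct := fun U c => ctcoS x.toKIdx b B cfg parS U (hTY x.toKIdx c)
  CLt := fun U c => cltcoS x.toKIdx b B cfg U (hTY x.toKIdx c)

/-- ★ **THE DIRECTION OPERATORS OF RECORD** (`∇_{U,μ}`, `∇*_{U,μ}` on the carrier, prefactor `η⁻¹`; the pins `h𝔡d ∕ h𝔡s`).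
[cite: Balaban1985BackgroundPropagators, (3.3) p.390, (3.8) p.392, (3.42) p.397] -/
def dirOpsWalkY : DirOps37 (opsWalkY x b B cfg parS bI) (Fin (d + 1)) where
  Dd := fun U μ => dirDcoS x.toKIdx b B cfg U μ
  Dsd := fun U μ => dirDscoS x.toKIdx b B cfg U μ

/-- ★ **THE DIRECTION LETTERS OF RECORD** (`P_□,μ`, `P^L_□,μ`, `Pᵗ_□,μ` at `h := h_□` with their per-direction kernels).
[cite: Balaban1985BackgroundPropagators, (3.88) p.409, (3.100) p.413; Balaban1984PropagatorsII, (2.39)–(2.40) pp.229–230] -/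
def dirLettersWalkY : DirLetters37 (opsWalkY x b B cfg parS bI) (Fin (d + 1)) where
  P := fun U c μ => pcoS x.toKIdx b B cfg U (hTY x.toKIdx c) μ
  PL := fun U c μ => plcoS x.toKIdx b B cfg U (hTY x.toKIdx c) μ
  Pt := fun U c μ => ptcoS x.toKIdx b B cfg U (hTY x.toKIdx c) μ
  KPd := kPdY x b bI
  KPLd := kPLdY x b bI
  KPtd := kPtdY x b bI

/-- ★ **THE SIZES OF RECORD** `κ(x)`: the nine row ∕ column sums of `B9WalkLettersKernelsRows` — explicit member-uniform constants (`N₃ = nbrCountY … 3`, `CB`, `c_R`,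
`C1F`, `C2F`, `sLipT`, `L`, `d`) times `M_h(x)⁻¹` or `M_h(x)⁻²` (print's «O(M⁻¹)» of (3.89); `kPD = 0`).
[cite: Balaban1985BackgroundPropagators, (3.89) p.409; Balaban1984PropagatorsII, (2.44) p.230] -/
def kappaWalkY : Sizes where
  kP := ((d : ℝ) + 1) * ((cR39 b)⁻¹ * cbY b * 2 * (nbrCountY d ℓ hd hL b₀ b₁ 3 : ℝ) * (((ℓ + 1 : ℕ) : ℝ)) * (5 / 8 * C1F d ℓ / x.toKIdx.Mh))
  kC := (cR39 b)⁻¹ * cbY b * (nbrCountY d ℓ hd hL b₀ b₁ 3 : ℝ) * (((ℓ + 1 : ℕ) : ℝ)) ^ 2 *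
    (((d : ℝ) + 1) * ((5 / 8) ^ 2 * C2F d ℓ / (x.toKIdx.Mh : ℝ) ^ 2) + avgLipY x)
  kPD := 0
  kCD := cbY b * ((d : ℝ) + 1) * (nbrCountY d ℓ hd hL b₀ b₁ 3 : ℝ) * (((ℓ + 1 : ℕ) : ℝ)) ^ 2 * (5 / 8 * C1F d ℓ / x.toKIdx.Mh)
  kPL := ((d : ℝ) + 1) * (cbY b * 2 * (nbrCountY d ℓ hd hL b₀ b₁ 3 : ℝ) * (((ℓ + 1 : ℕ) : ℝ)) * (5 / 8 * C1F d ℓ / x.toKIdx.Mh))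
  kCL := cbY b * ((d : ℝ) + 1) * (nbrCountY d ℓ hd hL b₀ b₁ 3 : ℝ) * (((ℓ + 1 : ℕ) : ℝ)) ^ 2 * ((5 / 8) ^ 2 * C2F d ℓ / (x.toKIdx.Mh : ℝ) ^ 2)
  kPt := ((d : ℝ) + 1) * ((cR39 b)⁻¹ * cbY b * 2 * (nbrCountY d ℓ hd hL b₀ b₁ 3 : ℝ) * (5 / 8 * C1F d ℓ / x.toKIdx.Mh))
  kCt := (cR39 b)⁻¹ * cbY b * (nbrCountY d ℓ hd hL b₀ b₁ 3 : ℝ) * (((d : ℝ) + 1) * ((5 / 8) ^ 2 * C2F d ℓ / (x.toKIdx.Mh : ℝ) ^ 2) + avgLipY x)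
  kCLt := cbY b * ((d : ℝ) + 1) * (nbrCountY d ℓ hd hL b₀ b₁ 3 : ℝ) * (5 / 8 * C1F d ℓ / x.toKIdx.Mh)

/-- ★ **THE `O(M⁻¹)` CONSTANT OF THE RECORD'S `K(h_□)` SIZES** (`Sizes.Bounded.row ∕ col` with `M = L·M_h`): `θ_W(C_ℓ) := L·[row numerators] + L·[column numerators]`,
member-uniform (the `M_h⁻²` terms bounded by `M_h⁻¹`): `kP + kC ≤ θ_W·M⁻¹` and `kPt + C_ℓ·kCt ≤ θ_W·M⁻¹` at every member (part 3, `bounded_kappaWalkY`).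
[cite: Balaban1985BackgroundPropagators, (3.89) p.409 («O(M⁻¹)»); Balaban1984PropagatorsII, (2.44) p.230] -/
def thetaWalkY (d ℓ : ℕ) (hd : 1 ≤ d + 1) (hL : Odd (ℓ + 1) ∧ 1 < ℓ + 1) (b₀ b₁ : ℝ) (b : Module.Basis κ ℝ 𝔸) (Cℓ : ℝ) : ℝ :=
  (((ℓ + 1 : ℕ) : ℝ)) * (((d : ℝ) + 1) * ((cR39 b)⁻¹ * cbY b * 2 * (nbrCountY d ℓ hd hL b₀ b₁ 3 : ℝ) * (((ℓ + 1 : ℕ) : ℝ)) * (5 / 8 * C1F d ℓ)) +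
      (cR39 b)⁻¹ * cbY b * (nbrCountY d ℓ hd hL b₀ b₁ 3 : ℝ) * (((ℓ + 1 : ℕ) : ℝ)) ^ 2 * (((d : ℝ) + 1) * ((5 / 8) ^ 2 * C2F d ℓ) + sLipT d ℓ)) +
    (((ℓ + 1 : ℕ) : ℝ)) * (((d : ℝ) + 1) * ((cR39 b)⁻¹ * cbY b * 2 * (nbrCountY d ℓ hd hL b₀ b₁ 3 : ℝ) * (5 / 8 * C1F d ℓ)) +
      Cℓ * ((cR39 b)⁻¹ * cbY b * (nbrCountY d ℓ hd hL b₀ b₁ 3 : ℝ) * (((d : ℝ) + 1) * ((5 / 8) ^ 2 * C2F d ℓ) + sLipT d ℓ)))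

/-- ★ **THE `O(1)` CONSTANT OF THE RECORD'S LEIBNIZ SIZES** (`Sizes.Bounded.leibD ∕ leibL ∕ leibT`): `K_W :=` the sum of the `M_h`-free numerators of `kCD`, `kPL`, `kCL`,
`kCLt` (each size is its numerator times `M_h⁻¹` or `M_h⁻²`, `M_h ≥ 1`). [cite: Balaban1985BackgroundPropagators, (3.100) p.413; Balaban1984PropagatorsII, (2.44) p.230] -/
def KcWalkY (d ℓ : ℕ) (hd : 1 ≤ d + 1) (hL : Odd (ℓ + 1) ∧ 1 < ℓ + 1) (b₀ b₁ : ℝ) (b : Module.Basis κ ℝ 𝔸) : ℝ :=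
  cbY b * ((d : ℝ) + 1) * (nbrCountY d ℓ hd hL b₀ b₁ 3 : ℝ) * (((ℓ + 1 : ℕ) : ℝ)) ^ 2 * (5 / 8 * C1F d ℓ) +
    (((d : ℝ) + 1) * (cbY b * 2 * (nbrCountY d ℓ hd hL b₀ b₁ 3 : ℝ) * (((ℓ + 1 : ℕ) : ℝ)) * (5 / 8 * C1F d ℓ)) +
      cbY b * ((d : ℝ) + 1) * (nbrCountY d ℓ hd hL b₀ b₁ 3 : ℝ) * (((ℓ + 1 : ℕ) : ℝ)) ^ 2 * ((5 / 8) ^ 2 * C2F d ℓ)) +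
    cbY b * ((d : ℝ) + 1) * (nbrCountY d ℓ hd hL b₀ b₁ 3 : ℝ) * (5 / 8 * C1F d ℓ)

open Classical in
/-- **the one-step thickening of the sites of `□̃(c)`**: the sites at torus distance `≤ 1` from `cubeDomY x c` — where the letters `∇_{U,μ}∘G′_□`, `K(h_□)G′_□`
read the bond variables (print: inside `□̃⁵`). [cite: Balaban1985BackgroundPropagators, p.410 L14–15 («Ω₀(□) ⊂ □̃⁵»), (3.3) p.390] -/
def nearDomY (c : ↥(cubes x.toKIdx.D.toDomains)) : Finset (SiteY x.toKIdx) :=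
  Finset.univ.filter fun z => ∃ w ∈ cubeDomY x c, B4TorusKernel.MultiPeriod.torusSupNorm (toKT x.toKIdx).NB (z.1 - w.1) ≤ 1

/-- ★ **THE AGREEMENT PREDICATE OF THE WALK READING** (print: «G′_□ depends on U restricted to Ω₀(□) ⊂ □̃⁵»; `W38OfOps.LocDep`): two configurations AGREE NEAR `□̃(c)`
when their bond variables at the sites one step from `□̃(c)` (forward and backward bonds, every direction) and their averaging transporters issuing from `□̃(c)`
coincide — the hypotheses of def-Y's `GsqY_congr_of_agree` on `cubeDomY x c`, thickened by one lattice step for the stencils of `∇_U` and `K(h_□)`.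
[cite: Balaban1985BackgroundPropagators, p.410 L14–15, (3.24) p.394, (3.19) p.393, (3.88) p.409] -/
def agreeWalkY (c : ↥(cubes x.toKIdx.D.toDomains)) (U U' : B.Cfg) : Prop :=
  (∀ z ∈ nearDomY x c, ∀ μ, UboxY x.toKIdx (cfg U) μ z = UboxY x.toKIdx (cfg U') μ z ∧
      UboxY x.toKIdx (cfg U) μ ((shiftY x.toKIdx μ).symm z) = UboxY x.toKIdx (cfg U') μ ((shiftY x.toKIdx μ).symm z)) ∧
    (∀ z ∈ cubeDomY x c, ∀ w, avgCoeffY x.toKIdx z w ≠ 0 → avgTrY x.toKIdx parS (cfg U) z w = avgTrY x.toKIdx parS (cfg U') z w)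

/-- ★ **THE WALK READING OF RECORD**: the evaluation `evSK` of the located test functions on the site carrier (`B9CoReadingCoordsS`) and the agreement predicate
`agreeWalkY`.  (Its `WalkReading.OK.off` clause holds in the `RelB` form `B9CoReadingCoordsS.off_bound_evSK`; the strict form displayed by the certificate is the
subject of the cell's ruling, bus WORD-W1.) [cite: Balaban1985BackgroundPropagators, (3.39) + (3.42) p.397, p.410 L14–15] -/
def rdWalkY : B9Cor38Whole.WalkReading (geo9Y x) B (XSK κ x.toKIdx) ↥(cubes x.toKIdx.D.toDomains) where
  ev := B9CoReadingCoordsS.evSK x.toKIdx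
  Agree := agreeWalkY x B cfg parS

/-! ## §2 The pins, by `rfl` -/

omit [DecidableEq κ] in
/-- the block maps, the support sets and the partition function of the record (pins `hblkS hblkYS hhS`; `S′ = S`).
[cite: Balaban1985BackgroundPropagators, (3.87) p.409, bookkeeping] -/
theorem opsWalkY_static :
    (opsWalkY x b B cfg parS bI).blk = blkSK x.toKIdx (sIK x.toKIdx bI) ∧ (opsWalkY x b B cfg parS bI).blkY = blkSK x.toKIdx (sIK x.toKIdx bI) ∧
    (opsWalkY x b B cfg parS bI).S = SblkY x bI ∧ (opsWalkY x b B cfg parS bI).S' = SblkY x bI ∧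
    (opsWalkY x b B cfg parS bI).h = hWalkY x ∧ (opsWalkY x b B cfg parS bI).hY = hWalkY x :=
  ⟨rfl, rfl, rfl, rfl, rfl, rfl⟩

omit [DecidableEq κ] in
/-- the kernels of the record ARE the kernels of `B9WalkLettersKernels`. [cite: Balaban1985BackgroundPropagators, (3.88)–(3.89) p.409, bookkeeping] -/
theorem opsWalkY_kernels :
    (opsWalkY x b B cfg parS bI).KP = kPY x b bI ∧ (opsWalkY x b B cfg parS bI).KC = kCY x b bI ∧ (opsWalkY x b B cfg parS bI).KPD = kPDY x ∧
    (opsWalkY x b B cfg parS bI).KCD = kCDY x b bI ∧ (opsWalkY x b B cfg parS bI).KPL = kPLY x b bI ∧ (opsWalkY x b B cfg parS bI).KCL = kCLY x b bI ∧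
    (opsWalkY x b B cfg parS bI).KPt = kPtY x b bI ∧ (opsWalkY x b B cfg parS bI).KCt = kCtY x b bI ∧ (opsWalkY x b B cfg parS bI).KCLt = kCLtY x b bI :=
  ⟨rfl, rfl, rfl, rfl, rfl, rfl, rfl, rfl, rfl⟩

omit [DecidableEq κ] in
/-- the `U`-dependent letters of the record (pins `hGpS hGsqF hDS hDsS hLapS` at `cfg := id`, `parS := parSymY`).
[cite: Balaban1985BackgroundPropagators, (3.87)–(3.88) pp.408–409, (3.42) p.397, bookkeeping] -/
theorem opsWalkY_letters (U : B.Cfg) (c : ↥(cubes x.toKIdx.D.toDomains)) :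
    (opsWalkY x b B cfg parS bI).Gp U = GcoS x.toKIdx b B cfg (GpY x.toKIdx parS) U ∧ (opsWalkY x b B cfg parS bI).Δa U = dacoS x.toKIdx b B cfg parS U ∧
    (opsWalkY x b B cfg parS bI).Gsq U c = gsqcoS x b B cfg parS c U ∧ (opsWalkY x b B cfg parS bI).D U = DcoS x.toKIdx b B cfg U ∧
    (opsWalkY x b B cfg parS bI).Dstar U = DscoS x.toKIdx b B cfg U ∧ (opsWalkY x b B cfg parS bI).Lap U = LcoS x.toKIdx b B cfg U ∧
    (opsWalkY x b B cfg parS bI).Cop U c = ccoS x.toKIdx b B cfg parS U (hTY x.toKIdx c) ∧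
    (opsWalkY x b B cfg parS bI).Ct U c = ctcoS x.toKIdx b B cfg parS U (hTY x.toKIdx c) ∧
    (opsWalkY x b B cfg parS bI).CL U c = clcoS x.toKIdx b (hTY x.toKIdx c) ∧
    (opsWalkY x b B cfg parS bI).CD U c = cdcoS x.toKIdx b B cfg U (hTY x.toKIdx c) ∧
    (opsWalkY x b B cfg parS bI).CLt U c = cltcoS x.toKIdx b B cfg U (hTY x.toKIdx c) ∧
    (opsWalkY x b B cfg parS bI).P U c = 0 ∧ (opsWalkY x b B cfg parS bI).PL U c = 0 ∧ (opsWalkY x b B cfg parS bI).Pt U c = 0 ∧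
    (opsWalkY x b B cfg parS bI).PD U c = 0 :=
  ⟨rfl, rfl, rfl, rfl, rfl, rfl, rfl, rfl, rfl, rfl, rfl, rfl, rfl, rfl, rfl⟩

omit [DecidableEq κ] in
/-- the direction operators and letters of the record (pins `h𝔡d h𝔡s`). [cite: Balaban1985BackgroundPropagators, (3.8) p.392, (3.88) p.409, bookkeeping] -/
theorem dirWalkY_letters (U : B.Cfg) (c : ↥(cubes x.toKIdx.D.toDomains)) (μ : Fin (d + 1)) :
    (dirOpsWalkY x b B cfg parS bI).Dd U μ = dirDcoS x.toKIdx b B cfg U μ ∧ (dirOpsWalkY x b B cfg parS bI).Dsd U μ = dirDscoS x.toKIdx b B cfg U μ ∧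
    (dirLettersWalkY x b B cfg parS bI).P U c μ = pcoS x.toKIdx b B cfg U (hTY x.toKIdx c) μ ∧
    (dirLettersWalkY x b B cfg parS bI).PL U c μ = plcoS x.toKIdx b B cfg U (hTY x.toKIdx c) μ ∧
    (dirLettersWalkY x b B cfg parS bI).Pt U c μ = ptcoS x.toKIdx b B cfg U (hTY x.toKIdx c) μ ∧
    (dirLettersWalkY x b B cfg parS bI).KPd c μ = kPdY x b bI c μ ∧ (dirLettersWalkY x b B cfg parS bI).KPLd c μ = kPLdY x b bI c μ ∧
    (dirLettersWalkY x b B cfg parS bI).KPtd c μ = kPtdY x b bI c μ :=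
  ⟨rfl, rfl, rfl, rfl, rfl, rfl, rfl, rfl⟩

omit [DecidableEq κ] in
/-- the certificate's shape of the pin `h𝔡d`: `Dd U = fun μ => η⁻¹ • coordOpK b (fun _ => (cdSL (cfg U) μ)|_ℝ)` (and `h𝔡s`).
[cite: Balaban1985BackgroundPropagators, (3.3) p.390, (3.8) p.392, bookkeeping] -/
theorem dirOpsWalkY_pins (U : B.Cfg) :
    (dirOpsWalkY x b B cfg parS bI).Dd U = (fun μ => (etaS x.toKIdx)⁻¹ • B9CoReadingCoords.coordOpK b (fun _ : Fin (d + 1) => (cdSL x.toKIdx (cfg U) μ).restrictScalars ℝ)) ∧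
    (dirOpsWalkY x b B cfg parS bI).Dsd U = (fun μ => (etaS x.toKIdx)⁻¹ • B9CoReadingCoords.coordOpK b (fun _ : Fin (d + 1) => (cdsSL x.toKIdx (cfg U) μ).restrictScalars ℝ)) :=
  ⟨rfl, rfl⟩

omit [FiniteDimensional ℝ 𝔸] [Fintype κ] in
/-- the walk reading's fields (for `LocalityDir` and `W38OfOps.LocDep`). [cite: Balaban1985BackgroundPropagators, p.410 L14–15, bookkeeping] -/
theorem rdWalkY_fields :
    (rdWalkY x B cfg parS (κ := κ)).ev = B9CoReadingCoordsS.evSK x.toKIdx ∧ (rdWalkY x B cfg parS (κ := κ)).Agree = agreeWalkY x B cfg parS :=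
  ⟨rfl, rfl⟩

omit [DecidableEq κ] in
/-- **`Identities₂.KPd_sum ∕ KPLd_sum ∕ KPtd_sum` AT THE RECORD** (with equality). [cite: Balaban1985BackgroundPropagators, (3.88) p.409, bookkeeping] -/
theorem dirLettersWalkY_sums (c : ↥(cubes x.toKIdx.D.toDomains)) (a y'' : (geo9Y x).Site) :
    (∑ μ, (dirLettersWalkY x b B cfg parS bI).KPd c μ a y'') = (opsWalkY x b B cfg parS bI).KP c a y'' ∧
    (∑ μ, (dirLettersWalkY x b B cfg parS bI).KPLd c μ a y'') = (opsWalkY x b B cfg parS bI).KPL c a y'' ∧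
    (∑ μ, (dirLettersWalkY x b B cfg parS bI).KPtd c μ a y'') = (opsWalkY x b B cfg parS bI).KPt c a y'' :=
  ⟨sum_kPdY x b bI c a y'', sum_kPLdY x b bI c a y'', sum_kPtdY x b bI c a y''⟩

end Literature.MathematicalPhysics.QuantumFieldTheory.Balaban1983to89.B9WalkLettersOps

end
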